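/-
Copyright (c) 2026 the pub-hodgecm-mathlib formalisation cell (harness21).  Prover seat hodgecm-mathlib-K2E3-p06 (g8) for the R90-TF SLAB,
section S10 (dealer R90-C138-plan (g3), DEAL #62 «the NON-SPLIT SATAKE-CURRENCY PINNED PAYER», 2026-09-05T02:47:11Z (1), 02:57:17Z; taken by lineage
03:10:51Z); h413 = `stmt-HodgeConjecture-24833`, route `HCCMUnconditional`.  THEOREMS ONLY (no `def`, no `instance`, no notation, no named-fact hypothesis,
no `sorry`); lane `--supports stmt-HodgeConjecture-24833`.
-/
import Summits.HodgeConjecture.HodgeConjecture.Theorems.R90S10PSLocalCharTransferPinnedLetters          -- ★ p864723 §2 `PSLocalCharTransferPinnedAt` (+ ★ (3′), ★ letter (3) `PSLocalCharTransferLetter`, ★ `LocalCharTransferLetter`)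
import Summits.HodgeConjecture.HodgeConjecture.Theorems.R90S10PSLocalCharTransfer                       -- ★ p864450 `localCharTransfer_cmPrincipalSeries_of_canonical` (letter (3) PAID at non-split `w`)
import Summits.HodgeConjecture.HodgeConjecture.Theorems.R90S10SphericalCharacterOfInducedEigencharacter -- ★ p864705 `unopSphericalCharacter_cmPrincipalSeries_eq_heckeEigencharacter` (the Satake junction)
import Summits.HodgeConjecture.HodgeConjecture.Theorems.R90S10IwasawaExponentCM                         -- ★ p864822 `isIwasawaExponent_cmBorel_cmLocalIntegralLevel` (the exponent by transport)
import Summits.HodgeConjecture.HodgeConjecture.Theorems.F0P2pTorusPairsAndVacuity                       -- ★ `continuous_of_smoothInd_ne_zero`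
import HarnessLib

/-!
# R90-TF ∕ S10 — THE NON-SPLIT PINNED PAYER IN SATAKE CURRENCY: the transfer partner of `ρ_w` is `i_G(χ̃)` and ITS HECKE PARAMETER IS
# `unopSphericalCharacter K_w (i_G(χ̃)) = λ_{χ̃}` (`Theorems/R90S10PSLocalCharTransferPinnedNonsplit.lean`; ns `Summit.HodgeConjecture.HodgeConjecture.R90.S10`)

Print: [Rogawski1990] §4.9 Lemma 4.9.2 pp. 55–56 («`Tr i_H(χ)(f^H) = ε · Tr i_G(χ̃)(f)`», `ε_w = 1` at unramified data); §12.2 pp. 173–174 (the `K_w`-spherical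
line of `i_G(χ̃)` and its parameter); §13.1 p. 199 ¶3 («`χ_ρ(f^H) = χ_π(f)` where `π = i_G(χ̃)`»); §13.6 p. 209 («`t_{π_v}` is the homomorphism by which `𝓗_v` acts on
the `K_v`-fixed vector»); [CartierCorvallis1979] §IV.1 (4.4), Cor. 4.1, §IV.2 (4.2.3) (`χ_{I(χ)}(f) = Sf(χ)`).

## WHY (DEAL #62; dealer R90-C138-plan (g3) 02:47:11Z (1) ∕ 02:57:17Z; p02 (g2) census 02:39:02Z; K2E3-p06 (g7) exit note 02:57:44Z; census (g8) 03:16:12Z)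
★ p864723 §2 `PSLocalCharTransferPinnedAt L μ w KG νQw νHw mHw mQw ρw t` («`ρ_w` HAS an admissible transfer partner `I` with a `KG`-line OF PARAMETER `t`») is the
letter the S10 keystone binds at `t := t₀ w`; ★ `exists_pinnedAt_of_abstractLetter` pays `∃ t, …` CHOICE-FREE but with `t` OPAQUE (the parameter of an abstract
witness).  At a NON-SPLIT unramified `w` the witness is KNOWN: ★ p864450 `localCharTransfer_cmPrincipalSeries_of_canonical` pays ★ letter (3)
`PSLocalCharTransferLetter`, whose conclusion ALREADY EXPOSES the inducing character `χt` and `Nonempty (I.Equiv (cmPrincipalSeries L 3 w χt))`.  This file turns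
that into the pinned statement WITH THE PARAMETER NAMED — no re-run of ★ p864450's construction:
* §1 (generic, any field) **`unopSphericalCharacter_eq_of_equiv`** — the spherical character is an isomorphism invariant (★ `sphericalFunctional_eq_of_equiv`,
  un-opped); absent from the tree so far.
* §2 **`exists_pinnedAt_cmPrincipalSeries_of_letter`** (hypothesis-first on ★ letter (3), any `KG KHw` pinned by `hKG hKH`): at the datum `ρ_w ≅ i_H(χ₂ ⊠ χ₁)` with
  a `K_H`-line, `∃ χt, Continuous χt ∧ ∃ h1 : (i_G χt).IsSpherical KG, PSLocalCharTransferPinnedAt … ρw (unopSphericalCharacter KG (cmPrincipalSeries L 3 w χt) h1)`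
  — THE PARAMETER OF THE PARTNER IS THAT OF `i_G(χt)` (currency-free).  `Continuous χt`: the `KG`-line of `I` carried along `I ≃ i_G(χt)` is a non-zero vector
  of `i_G(χt)` (★ `continuous_of_smoothInd_ne_zero` at the Borel triple of `U(Φ₃)`); sphericity along ★ `isSpherical_iff_of_equiv`; the pin along §1.
* §3 **`exists_pinnedAt_heckeEigencharacter_of_letter`** — SATAKE CURRENCY for ANY Iwasawa exponent `a` of `(B_w, KG)` (★ `IsIwasawaExponent`, by value) and
  ANY reading `δ_B^{1/2}(p)·χt(proj p) = wΛ(a p)·χΛ χt(a p)` BY VALUE, GUARDED to the `χt` that can occur (continuous, `i_G(χt)` `KG`-spherical — an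
  UNGUARDED reading over all `χt` is false: a ramified `χt` and `p ∈ B ∩ KG` with `χt(proj p) ≠ 1`, `a p = 0`): the parameter is ★ `IsIwasawaExponent.heckeEigencharacter
  h wΛ (χΛ χt) = ev ∘ 𝒮` (★ p864705 (3) at `KG`, Hecke pair from compact-open); and the inner-`∀` twin **`exists_pinnedAt_forall_reading_of_letter`** (the
  reading asked only of THE `χt` produced).
* §4 **`pinnedAt_satake_of_nonsplit`** — THE DEALER'S HEAD: §3 ∘ ★ p864450 at `KG = K_w = U(Φ₃)(𝒪_w)` with the exponent ★ p864822
  `isIwasawaExponent_cmBorel_cmLocalIntegralLevel L w hd eG hB hK` of transport data `(eG, hB, hK)` ((E1-c)'s currency): under p864450's standing hypotheses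
  (`hμω hmH hmQ hns hFL`) and the guarded reading through `a := hd.iwasawaExp ∘ eG`,
  `∃ χt, Continuous χt ∧ PSLocalCharTransferPinnedAt L μ w K_w νQw νHw mHw mQw ρw ((isIwasawaExponent_cmBorel_cmLocalIntegralLevel L w hd eG hB hK).heckeEigencharacter wΛ (χΛ χt))`.
HONEST LABEL: ★ helper (`--supports stmt-HodgeConjecture-24833 --as helper`); the G-side half of J-t₀ (explicit-parameter record of the (3′) partner) for S5's `hH4`
reading, NOT on S10's (P-rig) path; the reading `hread` is a by-value hypothesis dischargeable only by a CONCRETE entrywise transport `eG` (same status as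
(E1-c)'s `(eG, heG)`; nothing constructed here); `χt`'s dependence on `(χ₂, χ₁, μ_w)` stays hidden in S3's ★ `inducedCharTransferSigned_general`; closes no
socket; HC_CM is proved only modulo the 7 printed citations (2 remaining named inputs: hLiu418 = `stmt-HodgeConjecture-24832`, h413 = `stmt-HodgeConjecture-24833`)
until rung 0 closes; REL ≠ ★ ≠ BUILT.

## References
* [Rogawski1990] J. D. Rogawski, *Automorphic Representations of Unitary Groups in Three Variables*, Ann. of Math. Stud. 123 (1990), §4.5 p. 45; §4.9
  Lemma 4.9.2, (4.9.2), (4.9.4) pp. 55–56; §12.2 pp. 173–174; §13.1 p. 199 ¶3; §13.6 p. 209; §13.8 p. 218 L9 (ii), p. 219 L2–L3.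
* [CartierCorvallis1979] P. Cartier, *Representations of 𝔭-adic groups: a survey*, Proc. Sympos. Pure Math. 33.1 (1979), §IV.1 (4.4), Thm. 4.1, Cor. 4.1–4.2,
  §IV.2 (4.2.3).
* [BernsteinZelevinsky1976] I. N. Bernstein, A. V. Zelevinsky, *Representations of the group GL(n, F) where F is a non-archimedean local field*, Russ. Math.
  Surveys 31 (1976), §2.21–2.23.
* [BruhatTits1972] F. Bruhat, J. Tits, *Groupes réductifs sur un corps local I*, Publ. Math. IHÉS 41 (1972), Prop. (4.4.3).
-/

set_option autoImplicit false
set_option linter.dupNamespace false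

noncomputable section

open scoped RestrictedProduct Matrix MatrixGroups Valued WithZero
open Filter MeasureTheory NumberField IsDedekindDomain CompactlySupported MulAction
open Literature.NumberTheory.Rogawski1990 Literature.NumberTheory.Automorphic Literature.NumberTheory.Automorphic.UnitaryGroup
open Literature.NumberTheory.Automorphic.UnitaryGroup.CotangentForms Literature.NumberTheory.GaloisRepresentations
open Literature.NumberTheory.Automorphic.HermitianLattice Literature.NumberTheory.Automorphic.IsIwasawaExponent
open Summit.HodgeConjecture.HodgeConjecture.Cruxes.H413.K2E1TraceFormulaBeta
open Summit.HodgeConjecture.HodgeConjecture.Cruxes.H413.K2E1EigenvaluePackageOfSpherical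
open Summit.HodgeConjecture.HodgeConjecture.Cruxes.H413.K2E1EvpOfAutomorphicClass
open Summit.HodgeConjecture.HodgeConjecture.Cruxes.H413

namespace Summit.HodgeConjecture.HodgeConjecture.R90.S10

/-! ## §1 The spherical character is an isomorphism invariant -/

section Generic

variable {k : Type*} [Field k] {G : Type*} [Group G] (K : Subgroup G)
  {V V' : Type*} [AddCommGroup V] [Module k V] [AddCommGroup V'] [Module k V'] {ρ : Representation k G V} {ρ' : Representation k G V'}

/-- **`ρ ≃ ρ'` ⟹ `χ_ρ = χ_{ρ'}` on `ℋ(G, K)`** (un-opped spherical characters of `K`-spherical representations; the functional is an isomorphism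
invariant, ★ `sphericalFunctional_eq_of_equiv`). [cite: CartierCorvallis1979, §IV.1 Cor. 4.1] [cite: Rogawski1990, §13.6 p. 209] -/
theorem unopSphericalCharacter_eq_of_equiv (e : ρ.Equiv ρ') (h1 : ρ.IsSpherical K) (h1' : ρ'.IsSpherical K) :
    unopSphericalCharacter K ρ h1 = unopSphericalCharacter K ρ' h1' :=
  AlgHom.ext fun T => by
    rw [unopSphericalCharacter_apply, unopSphericalCharacter_apply, sphericalCharacter_apply, sphericalCharacter_apply,
      sphericalFunctional_eq_of_equiv K e]

end Generic

/-! ## §2 Letter (3) at the datum: the partner's parameter is the parameter of `i_G(χt)` -/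

section FromLetter

variable (L : Type) [Field L] [NumberField L] [IsCMField L] (μ : HeckeCharacter L) (w : Pl L)
  [MeasurableSpace (HLoc L w)] [BorelSpace (HLoc L w)] [MeasurableSpace (Gqs L w)] [BorelSpace (Gqs L w)]
  [∀ a : HLoc L w, MeasurableSpace (HLoc L w ⧸ Subgroup.centralizer ({a} : Set (HLoc L w)))]
  [∀ γ : Gqs L w, MeasurableSpace (Gqs L w ⧸ Subgroup.centralizer ({γ} : Set (Gqs L w)))]
  (KG : Subgroup (Gqs L w)) (KHw : Subgroup (HLoc L w)) (νQw : Measure (Gqs L w)) (νHw : Measure (HLoc L w))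
  [νQw.IsHaarMeasure] [νHw.IsHaarMeasure] (mHw : OrbitalMeasureFamily (HLoc L w)) (mQw : OrbitalMeasureFamily (Gqs L w))

/-! ### §2a The three bricks for a witness `I ≃ i_G(χt)` (the letter's `∃` unpacked) -/

omit [MeasurableSpace (HLoc L w)] [BorelSpace (HLoc L w)] [MeasurableSpace (Gqs L w)] [BorelSpace (Gqs L w)]
  [∀ a : HLoc L w, MeasurableSpace (HLoc L w ⧸ Subgroup.centralizer ({a} : Set (HLoc L w)))]
  [∀ γ : Gqs L w, MeasurableSpace (Gqs L w ⧸ Subgroup.centralizer ({γ} : Set (Gqs L w)))] [νQw.IsHaarMeasure] [νHw.IsHaarMeasure] in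
/-- **`i_G(χt)` is `KG`-spherical** when it is isomorphic to an `I` whose `KG`-fixed space is a line (★ `isSpherical_iff_of_equiv`).
[cite: CartierCorvallis1979, §IV.1 Cor. 4.1] [cite: Rogawski1990, §12.2 pp. 173–174] -/
theorem isSpherical_cmPrincipalSeries_of_equiv {W : Type} [AddCommGroup W] [Module ℂ W] (I : Representation ℂ (Gqs L w) W)
    (χt : ↥(torusU (conjLocal L (IsCMField.complexConj L) w) (cmLocalForm L 3 w)) →* ℂˣ)
    (hE : Nonempty (I.Equiv (cmPrincipalSeries L 3 w χt))) (hlineI : Module.finrank ℂ ↥(I.fixedPoints KG) = 1) :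
    (cmPrincipalSeries L 3 w χt).IsSpherical KG := by
  obtain ⟨E⟩ := hE
  exact (isSpherical_iff_of_equiv KG E).1 hlineI

omit [MeasurableSpace (HLoc L w)] [BorelSpace (HLoc L w)] [MeasurableSpace (Gqs L w)] [BorelSpace (Gqs L w)]
  [∀ a : HLoc L w, MeasurableSpace (HLoc L w ⧸ Subgroup.centralizer ({a} : Set (HLoc L w)))]
  [∀ γ : Gqs L w, MeasurableSpace (Gqs L w ⧸ Subgroup.centralizer ({γ} : Set (Gqs L w)))] [νQw.IsHaarMeasure] [νHw.IsHaarMeasure] in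
/-- **`χt` is continuous** when `i_G(χt)` is isomorphic to an `I` with a `KG`-LINE: the line carried along `E : I ≃ i_G(χt)` is a non-zero vector of
`i_G(χt)` (★ `continuous_of_smoothInd_ne_zero` at the Borel triple of `U(Φ₃)(L⁺_w)`). [cite: BernsteinZelevinsky1976, §2.21–2.23]
[cite: Rogawski1990, §12.2 pp. 173–174] -/
theorem continuous_of_equiv_cmPrincipalSeries {W : Type} [AddCommGroup W] [Module ℂ W] (I : Representation ℂ (Gqs L w) W)
    (χt : ↥(torusU (conjLocal L (IsCMField.complexConj L) w) (cmLocalForm L 3 w)) →* ℂˣ)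
    (hE : Nonempty (I.Equiv (cmPrincipalSeries L 3 w χt))) (hlineI : Module.finrank ℂ ↥(I.fixedPoints KG) = 1) :
    Continuous fun t : ↥(torusU (conjLocal L (IsCMField.complexConj L) w) (cmLocalForm L 3 w)) => ((χt t : ℂˣ) : ℂ) := by
  obtain ⟨E⟩ := hE
  haveI := locallyCompactSpace_cmBorelU L 3 w
  haveI : Nontrivial ↥(I.fixedPoints KG) := Module.nontrivial_of_finrank_pos (R := ℂ) (by omega)
  obtain ⟨x, hx⟩ := exists_ne (0 : ↥(I.fixedPoints KG))
  have hx' : (x : W) ≠ 0 := fun h => hx (Subtype.ext h)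
  have hEx : E.toLinearEquiv (x : W) ≠ 0 := fun h => hx' (E.toLinearEquiv.map_eq_zero_iff.1 h)
  exact F0P2pTorusPairsAndVacuity.continuous_of_smoothInd_ne_zero (cmBorelTriple L 3 w) χt (E.toLinearEquiv (x : W)) hEx

omit [BorelSpace (HLoc L w)] [BorelSpace (Gqs L w)] [νQw.IsHaarMeasure] [νHw.IsHaarMeasure] in
/-- **The pinned statement for a partner `I ≃ i_G(χt)` AT THE PARAMETER OF `i_G(χt)`**: admissible `I` with a `KG`-line carrying the (β″)-body ⟹
`PSLocalCharTransferPinnedAt … ρw (unopSphericalCharacter KG (cmPrincipalSeries L 3 w χt) h1)` (the pin by §1 along `E`).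
[cite: Rogawski1990, §4.9 Lemma 4.9.2 pp. 55–56; §13.6 p. 209] [cite: CartierCorvallis1979, §IV.1 Cor. 4.1] -/
theorem pinnedAt_of_equiv_cmPrincipalSeries {W : Type} [AddCommGroup W] [Module ℂ W] (I : Representation ℂ (Gqs L w) W)
    (χt : ↥(torusU (conjLocal L (IsCMField.complexConj L) w) (cmLocalForm L 3 w)) →* ℂˣ)
    (hE : Nonempty (I.Equiv (cmPrincipalSeries L 3 w χt))) (hlineI : Module.finrank ℂ ↥(I.fixedPoints KG) = 1)
    (h1 : (cmPrincipalSeries L 3 w χt).IsSpherical KG) (hadmI : I.IsAdmissible)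
    {Vw : Type} [AddCommGroup Vw] [Module ℂ Vw] (ρw : Representation ℂ (HLoc L w) Vw)
    (hβI : LocalCharTransferLetter L μ w νQw νHw mHw mQw ρw I) :
    PSLocalCharTransferPinnedAt L μ w KG νQw νHw mHw mQw ρw (unopSphericalCharacter KG (cmPrincipalSeries L 3 w χt) h1) := by
  obtain ⟨E⟩ := hE
  exact ⟨W, inferInstance, inferInstance, I, hadmI, ⟨hlineI, unopSphericalCharacter_eq_of_equiv KG E hlineI h1⟩, hβI⟩

/-! ### §2b Letter (3) read at the datum

Elaboration note (measured, K2E3-p06 (g8)): every step that re-checks the instance arguments of the carrier `SmoothInd (cmBorelTriple L 3 w).P …` of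
★ `cmPrincipalSeries` pays ≈ 0.5–1 s of `isDefEq` on the two presentations `torusU σ J` ∕ `(cmBorelTriple L 3 w).M` of the torus (★ `cmPrincipalSeries`
binds `χ` on `torusU`, its body inflates along `(cmBorelTriple …).proj`); the letters' telescopes are such terms, so the theorems below that unpack ★ letter
(3) carry a measured `maxHeartbeats` (same class as ★ p864450's). -/

set_option maxHeartbeats 800000 in
/-- **★ LETTER (3) READ AT THE DATUM, PARAMETER NAMED (currency-free).**  Under ⟪U⟫ at `w`, the level pins and unit volumes, for `ρ_w ≅ i_H(χ₂ ⊠ χ₁)`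
(`χ₁` smooth) with a `K_H`-line, ★ `PSLocalCharTransferLetter` yields a CONTINUOUS `χt` of `T₃(L⁺_w)` with `i_G(χt) = cmPrincipalSeries L 3 w χt` `KG`-SPHERICAL and
`PSLocalCharTransferPinnedAt … ρw (unopSphericalCharacter KG (cmPrincipalSeries L 3 w χt) h1)`: the admissible transfer partner of `ρ_w` has THE PARAMETER OF
`i_G(χt)`.  (Witness: the letter's own `I ≃ i_G(χt)`; §2a.) [cite: Rogawski1990, §4.9 Lemma 4.9.2 pp. 55–56; §12.2 pp. 173–174; §13.1 p. 199 ¶3; §13.6 p. 209]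
[cite: CartierCorvallis1979, §IV.1 Cor. 4.1] [cite: BernsteinZelevinsky1976, §2.21–2.23] -/
theorem exists_pinnedAt_cmPrincipalSeries_of_letter (h3 : PSLocalCharTransferLetter L μ w KG KHw νQw νHw mHw mQw)
    (hU : ∀ W : PlacesOver L w, Algebra.IsUnramifiedAt (𝓞 ↥(maximalRealSubfield L)) W.1.asIdeal ∧ μ.IsUnramifiedAt W.1)
    (hKG : KG = cmLocalIntegralLevel L 3 (qsForm L) w)
    (hKH : KHw = (cmLocalIntegralLevel L 2 (Matrix.of fun i j : Fin 2 => if i.val + j.val + 1 = 2 then (1 : L) else 0) w).prod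
      (cmLocalIntegralLevel L 1 (Matrix.of fun i j : Fin 1 => if i.val + j.val + 1 = 1 then (1 : L) else 0) w))
    (hvolH : νHw (KHw : Set (HLoc L w)) = 1) (hvolG : νQw (KG : Set (Gqs L w)) = 1)
    (χ₂ : ↥(torusU (conjLocal L (IsCMField.complexConj L) w) (cmLocalForm L 2 w)) →* ℂˣ) (χ₁ : H1Loc L w →* ℂˣ)
    (hχ₁ : IsOpen ((χ₁.ker : Subgroup (H1Loc L w)) : Set (H1Loc L w)))
    {Vw : Type} [AddCommGroup Vw] [Module ℂ Vw] (ρw : Representation ℂ (HLoc L w) Vw)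
    (hρ : Nonempty (ρw.Equiv (cmPrincipalSeriesH L w χ₂ χ₁))) (hline : Module.finrank ℂ ↥(ρw.fixedPoints KHw) = 1) :
    ∃ χt : ↥(torusU (conjLocal L (IsCMField.complexConj L) w) (cmLocalForm L 3 w)) →* ℂˣ,
      Continuous (fun t => ((χt t : ℂˣ) : ℂ)) ∧ ∃ h1 : (cmPrincipalSeries L 3 w χt).IsSpherical KG,
        PSLocalCharTransferPinnedAt L μ w KG νQw νHw mHw mQw ρw (unopSphericalCharacter KG (cmPrincipalSeries L 3 w χt) h1) := by
  obtain ⟨χt, W, _, _, I, hE, hadmI, hlineI, hβI⟩ := h3 hU hKG hKH hvolH hvolG χ₂ χ₁ hχ₁ ρw hρ hline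
  exact ⟨χt, continuous_of_equiv_cmPrincipalSeries L w KG I χt hE hlineI, isSpherical_cmPrincipalSeries_of_equiv L w KG I χt hE hlineI,
    pinnedAt_of_equiv_cmPrincipalSeries L μ w KG νQw νHw mHw mQw I χt hE hlineI _ hadmI ρw hβI⟩

/-! ## §3 Satake currency: the parameter read through an Iwasawa exponent of `(B_w, KG)` -/

set_option maxHeartbeats 800000 in
/-- **THE PINNED PARTNER IN SATAKE CURRENCY, ANY EXPONENT, READING BY VALUE.**  ★ letter (3) at the datum; `a` an Iwasawa exponent for `(B_w, KG)` BY VALUE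
(★ `IsIwasawaExponent`; e.g. ★ p864822 by transport); weights `wΛ` and `χΛ χt` on `Λ` with the reading `δ_B^{1/2}(p)·χt(proj p) = wΛ(a p)·χΛ χt(a p)` BY VALUE for
every CONTINUOUS `χt` with `i_G(χt)` `KG`-SPHERICAL (the guard is exactly what the proof supplies; unguarded the reading is false).  Then `∃ χt` continuous with
`PSLocalCharTransferPinnedAt … ρw (h.heckeEigencharacter wΛ (χΛ χt))` — the partner's parameter IS the Hecke eigencharacter `λ = ev_{χΛ χt} ∘ 𝒮_{wΛ}` (★ p864705 (3);
`KG` compact open ⇒ Hecke pair). [cite: Rogawski1990, §4.5 p. 45; §12.2 pp. 173–174; §13.6 p. 209; §4.9 Lemma 4.9.2 pp. 55–56]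
[cite: CartierCorvallis1979, §IV.1 (4.4), Cor. 4.1; §IV.2 (4.2.3)] -/
theorem exists_pinnedAt_heckeEigencharacter_of_letter (h3 : PSLocalCharTransferLetter L μ w KG KHw νQw νHw mHw mQw)
    {Λ : Type*} [AddCommGroup Λ] {a : ↥(unitaryGroupOfForm (conjLocal L (IsCMField.complexConj L) w) (cmLocalForm L 3 w)) → Λ}
    (h : IsIwasawaExponent (cmBorelTriple L 3 w).P KG a) (wΛ : Multiplicative Λ →* ℂ)
    (χΛ : (↥(torusU (conjLocal L (IsCMField.complexConj L) w) (cmLocalForm L 3 w)) →* ℂˣ) → (Multiplicative Λ →* ℂ))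
    (hread : haveI := locallyCompactSpace_cmBorelU L 3 w
      ∀ χt : ↥(torusU (conjLocal L (IsCMField.complexConj L) w) (cmLocalForm L 3 w)) →* ℂˣ,
        Continuous (fun t => ((χt t : ℂˣ) : ℂ)) → (cmPrincipalSeries L 3 w χt).IsSpherical KG →
          ∀ p : ↥(cmBorelTriple L 3 w).P,
            ((rootDeltaChar (cmBorelTriple L 3 w).P p : ℂˣ) : ℂ) * ((χt ((cmBorelTriple L 3 w).proj p) : ℂˣ) : ℂ) =
              wΛ (Multiplicative.ofAdd (a p)) * χΛ χt (Multiplicative.ofAdd (a p)))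
    (hU : ∀ W : PlacesOver L w, Algebra.IsUnramifiedAt (𝓞 ↥(maximalRealSubfield L)) W.1.asIdeal ∧ μ.IsUnramifiedAt W.1)
    (hKG : KG = cmLocalIntegralLevel L 3 (qsForm L) w)
    (hKH : KHw = (cmLocalIntegralLevel L 2 (Matrix.of fun i j : Fin 2 => if i.val + j.val + 1 = 2 then (1 : L) else 0) w).prod
      (cmLocalIntegralLevel L 1 (Matrix.of fun i j : Fin 1 => if i.val + j.val + 1 = 1 then (1 : L) else 0) w))
    (hvolH : νHw (KHw : Set (HLoc L w)) = 1) (hvolG : νQw (KG : Set (Gqs L w)) = 1)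
    (χ₂ : ↥(torusU (conjLocal L (IsCMField.complexConj L) w) (cmLocalForm L 2 w)) →* ℂˣ) (χ₁ : H1Loc L w →* ℂˣ)
    (hχ₁ : IsOpen ((χ₁.ker : Subgroup (H1Loc L w)) : Set (H1Loc L w)))
    {Vw : Type} [AddCommGroup Vw] [Module ℂ Vw] (ρw : Representation ℂ (HLoc L w) Vw)
    (hρ : Nonempty (ρw.Equiv (cmPrincipalSeriesH L w χ₂ χ₁))) (hline : Module.finrank ℂ ↥(ρw.fixedPoints KHw) = 1) :
    ∃ χt : ↥(torusU (conjLocal L (IsCMField.complexConj L) w) (cmLocalForm L 3 w)) →* ℂˣ,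
      Continuous (fun t => ((χt t : ℂˣ) : ℂ)) ∧ PSLocalCharTransferPinnedAt L μ w KG νQw νHw mHw mQw ρw (h.heckeEigencharacter wΛ (χΛ χt)) := by
  obtain ⟨χt, hχt, h1, hpin⟩ :=
    exists_pinnedAt_cmPrincipalSeries_of_letter L μ w KG KHw νQw νHw mHw mQw h3 hU hKG hKH hvolH hvolG χ₂ χ₁ hχ₁ ρw hρ hline
  have hK : IsCompact (KG : Set (Gqs L w)) ∧ IsOpen (KG : Set (Gqs L w)) := by
    rw [hKG]; exact isCompact_isOpen_cmLocalIntegralLevel L 3 (qsForm L) w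
  haveI : IsHeckeTriple (⊤ : Submonoid ↥(unitaryGroupOfForm (conjLocal L (IsCMField.complexConj L) w) (cmLocalForm L 3 w))) KG KG :=
    isHeckeTriple_top_of_isCompact_isOpen KG hK.1 hK.2
  refine ⟨χt, hχt, ?_⟩
  rw [← unopSphericalCharacter_cmPrincipalSeries_eq_heckeEigencharacter L 3 w χt KG hK.2 h wΛ (χΛ χt) (hread χt hχt h1) h1]
  exact hpin

set_option maxHeartbeats 800000 in
/-- **Inner-`∀` twin**: the reading is asked only of THE `χt` produced — `∃ χt` continuous, `i_G(χt)` `KG`-spherical, such that for EVERY exponent reading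
`(wΛ, χΛ')` of `δ_B^{1/2}·(χt ∘ proj)` through `a`, `PSLocalCharTransferPinnedAt … ρw (h.heckeEigencharacter wΛ χΛ')`. [cite: Rogawski1990, §12.2 pp. 173–174; §13.6 p. 209]
[cite: CartierCorvallis1979, §IV.1 (4.4), Cor. 4.1] -/
theorem exists_pinnedAt_forall_reading_of_letter (h3 : PSLocalCharTransferLetter L μ w KG KHw νQw νHw mHw mQw)
    {Λ : Type*} [AddCommGroup Λ] {a : ↥(unitaryGroupOfForm (conjLocal L (IsCMField.complexConj L) w) (cmLocalForm L 3 w)) → Λ}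
    (h : IsIwasawaExponent (cmBorelTriple L 3 w).P KG a)
    (hU : ∀ W : PlacesOver L w, Algebra.IsUnramifiedAt (𝓞 ↥(maximalRealSubfield L)) W.1.asIdeal ∧ μ.IsUnramifiedAt W.1)
    (hKG : KG = cmLocalIntegralLevel L 3 (qsForm L) w)
    (hKH : KHw = (cmLocalIntegralLevel L 2 (Matrix.of fun i j : Fin 2 => if i.val + j.val + 1 = 2 then (1 : L) else 0) w).prod
      (cmLocalIntegralLevel L 1 (Matrix.of fun i j : Fin 1 => if i.val + j.val + 1 = 1 then (1 : L) else 0) w))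
    (hvolH : νHw (KHw : Set (HLoc L w)) = 1) (hvolG : νQw (KG : Set (Gqs L w)) = 1)
    (χ₂ : ↥(torusU (conjLocal L (IsCMField.complexConj L) w) (cmLocalForm L 2 w)) →* ℂˣ) (χ₁ : H1Loc L w →* ℂˣ)
    (hχ₁ : IsOpen ((χ₁.ker : Subgroup (H1Loc L w)) : Set (H1Loc L w)))
    {Vw : Type} [AddCommGroup Vw] [Module ℂ Vw] (ρw : Representation ℂ (HLoc L w) Vw)
    (hρ : Nonempty (ρw.Equiv (cmPrincipalSeriesH L w χ₂ χ₁))) (hline : Module.finrank ℂ ↥(ρw.fixedPoints KHw) = 1) :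
    ∃ χt : ↥(torusU (conjLocal L (IsCMField.complexConj L) w) (cmLocalForm L 3 w)) →* ℂˣ,
      Continuous (fun t => ((χt t : ℂˣ) : ℂ)) ∧ ∃ _h1 : (cmPrincipalSeries L 3 w χt).IsSpherical KG,
        ∀ (wΛ χΛ' : Multiplicative Λ →* ℂ),
          (haveI := locallyCompactSpace_cmBorelU L 3 w
            ∀ p : ↥(cmBorelTriple L 3 w).P,
              ((rootDeltaChar (cmBorelTriple L 3 w).P p : ℂˣ) : ℂ) * ((χt ((cmBorelTriple L 3 w).proj p) : ℂˣ) : ℂ) =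
                wΛ (Multiplicative.ofAdd (a p)) * χΛ' (Multiplicative.ofAdd (a p))) →
            PSLocalCharTransferPinnedAt L μ w KG νQw νHw mHw mQw ρw (h.heckeEigencharacter wΛ χΛ') := by
  obtain ⟨χt, hχt, h1, hpin⟩ :=
    exists_pinnedAt_cmPrincipalSeries_of_letter L μ w KG KHw νQw νHw mHw mQw h3 hU hKG hKH hvolH hvolG χ₂ χ₁ hχ₁ ρw hρ hline
  have hK : IsCompact (KG : Set (Gqs L w)) ∧ IsOpen (KG : Set (Gqs L w)) := by
    rw [hKG]; exact isCompact_isOpen_cmLocalIntegralLevel L 3 (qsForm L) w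
  haveI : IsHeckeTriple (⊤ : Submonoid ↥(unitaryGroupOfForm (conjLocal L (IsCMField.complexConj L) w) (cmLocalForm L 3 w))) KG KG :=
    isHeckeTriple_top_of_isCompact_isOpen KG hK.1 hK.2
  refine ⟨χt, hχt, h1, fun wΛ χΛ' hread => ?_⟩
  rw [← unopSphericalCharacter_cmPrincipalSeries_eq_heckeEigencharacter L 3 w χt KG hK.2 h wΛ χΛ' hread h1]
  exact hpin

end FromLetter

/-! ## §4 THE HEAD: non-split `w`, `KG = K_w = U(Φ₃)(𝒪_w)`, the exponent of `(B_w, K_w)` by transport -/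

section Nonsplit

variable (L : Type) [Field L] [NumberField L] [IsCMField L] (μ : HeckeCharacter L) (w : Pl L)
  [MeasurableSpace (HLoc L w)] [BorelSpace (HLoc L w)] [MeasurableSpace (Gqs L w)] [BorelSpace (Gqs L w)]
  [∀ a : HLoc L w, MeasurableSpace (HLoc L w ⧸ Subgroup.centralizer ({a} : Set (HLoc L w)))]
  [∀ a : HLoc L w, BorelSpace (HLoc L w ⧸ Subgroup.centralizer ({a} : Set (HLoc L w)))]
  [∀ γ : Gqs L w, MeasurableSpace (Gqs L w ⧸ Subgroup.centralizer ({γ} : Set (Gqs L w)))]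
  [∀ γ : Gqs L w, BorelSpace (Gqs L w ⧸ Subgroup.centralizer ({γ} : Set (Gqs L w)))]
  (KHw : Subgroup (HLoc L w)) (νQw : Measure (Gqs L w)) (νHw : Measure (HLoc L w))
  [νQw.IsHaarMeasure] [νHw.IsHaarMeasure] [νQw.IsMulRightInvariant] [νHw.IsMulRightInvariant]
  (mHw : OrbitalMeasureFamily (HLoc L w)) (mQw : OrbitalMeasureFamily (Gqs L w))

set_option maxHeartbeats 800000 in
/-- **S10 HEAD (DEAL #62) — THE NON-SPLIT PINNED PAYER IN SATAKE CURRENCY.**  At a finite place `w` of `L⁺` NON-SPLIT in `L` (`hns`), under ★ p864450's standing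
hypotheses (`μ|𝔸_{L⁺} = ω` `hμω`, CANONICAL orbital-measure families `hmH hmQ`, the unit identity `hFL` at `w`), for TRANSPORT DATA `eG : G_w ≃* U(σ_w, J₀)(K_w)` onto a
model carrying an unramified conjugation datum `hd`, with `eG⁻¹(B) = B_w` and `eG⁻¹(K₀) = K_w` BY VALUE (`hB hK`, (E1-c)'s currency) and the GUARDED reading BY VALUE
`δ_B^{1/2}(p)·χt(proj p) = wΛ(a p)·χΛ χt(a p)`, `a := hd.iwasawaExp ∘ eG` (for continuous `χt` with `i_G(χt)` `K_w`-spherical): at every datum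
`ρ_w ≅ i_H(χ₂ ⊠ χ₁)` (`χ₁` smooth) with a `K_H`-line (⟪U⟫ at `w`, unit volumes), there is a CONTINUOUS `χt` such that `ρ_w` has an admissible transfer partner with a
`K_w`-line OF PARAMETER `λ = (isIwasawaExponent_cmBorel_cmLocalIntegralLevel L w hd eG hB hK).heckeEigencharacter wΛ (χΛ χt)` — ★ `PSLocalCharTransferPinnedAt` BY NAME.
Print: `I = i_G(χ̃ μ̃)`, `t = 𝒮_G(χ̃ μ̃)` [Lemma 4.9.2, `ε_w = 1`; §12.2; §13.1 p. 199 ¶3; §13.6 p. 209].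
[cite: Rogawski1990, §4.9 Lemma 4.9.2 pp. 55–56; §4.5 p. 45; §12.2 pp. 173–174; §13.1 p. 199 ¶3; §13.6 p. 209; §13.8 p. 219 L3]
[cite: CartierCorvallis1979, §IV.1 (4.4), Cor. 4.1; §IV.2 (4.2.3)] [cite: BruhatTits1972, Prop. (4.4.3)] -/
theorem pinnedAt_satake_of_nonsplit
    (hμω : ∀ x : Literature.NumberTheory.GaloisRepresentations.ideleGroup ↥(maximalRealSubfield L),
      μ (AdeleRing.ideleBaseChange (↥(maximalRealSubfield L)) L x) = quadraticHeckeCharCM L x)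
    (hmH : mHw.IsCanonical (IsLocalGRegular L w) νHw)
    (hmQ : mQw.IsCanonical (fun γ => IsRegularElt (γ.val : GL (Fin 3) (UnitaryGroup.LocalRing L w))) νQw)
    (hns : ∀ W : PlacesOver L w, IsCMField.complexConj L • W.1 = W.1)
    (hFL : IsLocalUnitTransfer L (qsForm L) w
      ((finExplicitCollection L (qsForm L) μ (finExplicitDelta_conj_left_all L (qsForm L) μ) (finExplicitDelta_conj_right_all L (qsForm L) μ)) w) mHw mQw)
    {Kw : Type*} [Field Kw] [Valued Kw ℤᵐ⁰] {σw : Kw →+* Kw} {ϖ : Kw} (hd : UnramifiedLocalConjDatum σw ϖ)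
    (eG : Gqs L w ≃* ↥(unitaryGroupOfForm σw ((StdForm.antidiagonal 3).over Kw)))
    (hB : (borelU σw ((StdForm.antidiagonal 3).over Kw)).comap eG.toMonoidHom = (cmBorelTriple L 3 w).P)
    (hK : (unitaryInt σw ((StdForm.antidiagonal 3).over Kw)).comap eG.toMonoidHom = cmLocalIntegralLevel L 3 (qsForm L) w)
    (wΛ : Multiplicative (Fin 3 → ℤ) →* ℂ)
    (χΛ : (↥(torusU (conjLocal L (IsCMField.complexConj L) w) (cmLocalForm L 3 w)) →* ℂˣ) → (Multiplicative (Fin 3 → ℤ) →* ℂ))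
    (hread : haveI := locallyCompactSpace_cmBorelU L 3 w
      ∀ χt : ↥(torusU (conjLocal L (IsCMField.complexConj L) w) (cmLocalForm L 3 w)) →* ℂˣ,
        Continuous (fun t => ((χt t : ℂˣ) : ℂ)) → (cmPrincipalSeries L 3 w χt).IsSpherical (cmLocalIntegralLevel L 3 (qsForm L) w) →
          ∀ p : ↥(cmBorelTriple L 3 w).P,
            ((rootDeltaChar (cmBorelTriple L 3 w).P p : ℂˣ) : ℂ) * ((χt ((cmBorelTriple L 3 w).proj p) : ℂˣ) : ℂ) =
              wΛ (Multiplicative.ofAdd (hd.iwasawaExp (N := 3) (eG p.1))) * χΛ χt (Multiplicative.ofAdd (hd.iwasawaExp (N := 3) (eG p.1))))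
    (hU : ∀ W : PlacesOver L w, Algebra.IsUnramifiedAt (𝓞 ↥(maximalRealSubfield L)) W.1.asIdeal ∧ μ.IsUnramifiedAt W.1)
    (hKH : KHw = (cmLocalIntegralLevel L 2 (Matrix.of fun i j : Fin 2 => if i.val + j.val + 1 = 2 then (1 : L) else 0) w).prod
      (cmLocalIntegralLevel L 1 (Matrix.of fun i j : Fin 1 => if i.val + j.val + 1 = 1 then (1 : L) else 0) w))
    (hvolH : νHw (KHw : Set (HLoc L w)) = 1) (hvolG : νQw (cmLocalIntegralLevel L 3 (qsForm L) w : Set (Gqs L w)) = 1)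
    (χ₂ : ↥(torusU (conjLocal L (IsCMField.complexConj L) w) (cmLocalForm L 2 w)) →* ℂˣ) (χ₁ : H1Loc L w →* ℂˣ)
    (hχ₁ : IsOpen ((χ₁.ker : Subgroup (H1Loc L w)) : Set (H1Loc L w)))
    {Vw : Type} [AddCommGroup Vw] [Module ℂ Vw] (ρw : Representation ℂ (HLoc L w) Vw)
    (hρ : Nonempty (ρw.Equiv (cmPrincipalSeriesH L w χ₂ χ₁))) (hline : Module.finrank ℂ ↥(ρw.fixedPoints KHw) = 1) :
    ∃ χt : ↥(torusU (conjLocal L (IsCMField.complexConj L) w) (cmLocalForm L 3 w)) →* ℂˣ,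
      Continuous (fun t => ((χt t : ℂˣ) : ℂ)) ∧
        PSLocalCharTransferPinnedAt L μ w (cmLocalIntegralLevel L 3 (qsForm L) w) νQw νHw mHw mQw ρw
          ((isIwasawaExponent_cmBorel_cmLocalIntegralLevel L w hd eG hB hK).heckeEigencharacter wΛ (χΛ χt)) :=
  exists_pinnedAt_heckeEigencharacter_of_letter L μ w (cmLocalIntegralLevel L 3 (qsForm L) w) KHw νQw νHw mHw mQw
    (localCharTransfer_cmPrincipalSeries_of_canonical L μ w (cmLocalIntegralLevel L 3 (qsForm L) w) KHw νQw νHw mHw mQw hμω hmH hmQ hns hFL)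
    (isIwasawaExponent_cmBorel_cmLocalIntegralLevel L w hd eG hB hK) wΛ χΛ hread hU rfl hKH hvolH hvolG χ₂ χ₁ hχ₁ ρw hρ hline

end Nonsplit

end Summit.HodgeConjecture.HodgeConjecture.R90.S10

end
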